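/-
Copyright (c) 2026 the pub-hodgecm-mathlib formalisation cell (harness21).  Prover seat hodgecm-mathlib-K2E3-p37 (g2), Track B «K2-LIT» ∕ h413 =
`stmt-HodgeConjecture-24833`, line `K2_E3_EllipticInputs`, unit U4 «Keys», PART «U4Keys» socket :182 (U4f-χ₁-ram-one-pos)
`sig_K2E3KeysThmTwoContractingRamifiedCharOnePosDepth` (L4 line-lead K2E3-plan (g5); brick (B1a) of this seat's memo `K2/K2E3-p37/g2/MEMO-PosA-Recut.K2E3-p37-g2.md`):
«A CONTINUOUS CHARACTER OF `(L ⊗ L⁺_v)ˣ` HAS A LEVEL» — from :182's binder `h₁ : Continuous χ₁` to the smoothness letter `hsmooth` of ★ `K2E3TwoDepthConductorExponents`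
(this seat, (B1b)).  REPORT-FIRST 2026-09-04.
-/
import Summits.HodgeConjecture.HodgeConjecture.Theorems.F0P3cStCharTSShellFn   -- ★ (LH6 lineage): `exists_isOpen_subgroup_subset_units_localRing`; brings ★ `Complex.units_eq_one_of_forall_norm_pow_sub_one_lt` («ℂˣ has no small subgroups»)
import Literature.NumberTheory.Automorphic.QuadraticLocalBaseChange             -- ★ `UnitaryGroup.exists_exp_lt_of_mem_nhds` (a neighbourhood in `L_w` contains a valuation ball)
import HarnessLib

/-!
# K2 ∕ E3 «EllipticInputs», unit U4 «Keys» — (U4f-χ₁-ram-one-pos), brick (B1a): A CONTINUOUS CHARACTER OF `(L ⊗ L⁺_v)ˣ` IS TRIVIAL ON A CONGRUENCE BALL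
# «`Continuous χ₁` ⟹ `∃ N, χ₁ = 1` on `{u : ∀ w′, |u_{w′} − 1|_{w′} ≤ |ϖ|^N}`»   [BushnellHenniart2006 §1.1, §1.5; Rogawski1990 §12.2]

Cell hodgecm-mathlib, Track B «K2-LIT», crux item H413 = stmt-HodgeConjecture-24833 (route `HCCMUnconditional`, no route verbs); target BY NAME the OPEN tier-0 leaf
`…K2E3EllipticInputs.U4Keys.sig_K2E3KeysThmTwoContractingRamifiedCharOnePosDepth` (U4Keys ED. 8 :182).  Author K2E3-p37 (g2).  `--supports stmt-HodgeConjecture-24833 --as helper`;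
THEOREMS ONLY; CM level, frame-light (a place `w ∣ v` carrying the uniformiser `ϖ` that measures the level; ANY finite `v`, split or not).  NOT THE PAYER.

THE POINT.  :182 hands the payer `h₁ : Continuous fun x => ((χ₁ x : ℂˣ) : ℂ)`; the A_pos bricks (★ p861880, ★ p862709, ★ p862772, ★ `K2E3TwoDepthConductorExponents` …) want the
LEVEL letter `∃ N, ∀ u, (∀ w′, |u_{w′} − 1| ≤ |ϖ|^N) → χ₁ u = 1`.  Proof: `χ₁` is continuous into `ℂˣ` (`Units.continuous_iff`); the preimage of the ball `‖z − 1‖ < 1`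
contains an open subgroup `H` of `E_vˣ = (Π_{w′} L_{w′})ˣ` (★ `exists_isOpen_subgroup_subset_units_localRing`), and `χ₁(H)` is a subgroup of `ℂˣ` inside that ball, hence trivial
(★ `Complex.units_eq_one_of_forall_norm_pow_sub_one_lt`); finally `H ∈ 𝓝 1` contains a congruence ball: transport along Mathlib `ContinuousMulEquiv.piUnits`, `nhds_pi`, the
units embedding `Units.isEmbedding_val₀` and ★ `exists_exp_lt_of_mem_nhds` at each `w′`, with `N := 1 + Σ_{w′} n_{w′}` (`|ϖ|^N = exp(−N)`).
* §1 **`exists_level_of_continuous`** — the letter `hsmooth` of ★ `K2E3TwoDepthConductorExponents.exists_conductors_and_exponents`, from `h₁` alone.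
HONEST LABEL: HC_CM is proved only modulo the 7 printed citations (2 remaining named inputs: hLiu418 = stmt-HodgeConjecture-24832, h413 = stmt-HodgeConjecture-24833)
until rung 0 closes; count-neutral — this file does NOT pay the leaf; no printed citation is discharged.

## References
* [BushnellHenniart2006] C. J. Bushnell, G. Henniart, *The Local Langlands Conjecture for GL(2)*, Grundlehren 335 (2006), §1.1 (congruence subgroups), §1.5 (smooth characters).
* [Rogawski1990] J. D. Rogawski, *Automorphic Representations of Unitary Groups in Three Variables*, Ann. of Math. Stud. 123 (1990), §12.2 p. 173.
-/

set_option autoImplicit false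
-- the mandated namespace repeats the single-problem summit's segment (`HodgeConjecture.HodgeConjecture`)
set_option linter.dupNamespace false

noncomputable section

open NumberField IsDedekindDomain Topology Filter
open scoped WithZero Valued
open Literature.NumberTheory Literature.NumberTheory.Automorphic Literature.NumberTheory.Automorphic.UnitaryGroup

namespace Summit.HodgeConjecture.HodgeConjecture.Cruxes.H413.K2E3LocalCharacterSmoothLevel

open Summit.HodgeConjecture.HodgeConjecture.Cruxes.H413

variable (L : Type) [Field L] [NumberField L] (v : HeightOneSpectrum (𝓞 ↥(maximalRealSubfield L)))
  (w : PlacesOver L v) {ϖ : w.1.adicCompletion L} (hϖ : Valued.v ϖ = WithZero.exp (-1 : ℤ))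

include hϖ in
/-- **A CONTINUOUS CHARACTER OF `E_vˣ = (L ⊗ L⁺_v)ˣ` HAS A LEVEL**: if `x ↦ (χ₁ x : ℂ)` is continuous then for some `N` every unit `u` with `|u_{w′} − 1|_{w′} ≤ |ϖ|^N` at all
`w′ ∣ v` has `χ₁ u = 1` (`ϖ` a uniformiser at the chosen `w`; `|ϖ|^N = exp(−N)` is read in the common value group `ℤᵐ⁰`).  This is the letter `hsmooth` of
★ `K2E3TwoDepthConductorExponents.exists_conductors_and_exponents`, derived from :182's `h₁`. [cite: BushnellHenniart2006, §1.1, §1.5] [cite: Rogawski1990, §12.2 p. 173] -/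
theorem exists_level_of_continuous (χ₁ : (LocalRing L v)ˣ →* ℂˣ) (h₁ : Continuous fun x => ((χ₁ x : ℂˣ) : ℂ)) :
    ∃ N : ℕ, ∀ u : (LocalRing L v)ˣ, (∀ w' : PlacesOver L v, Valued.v (((u : LocalRing L v) w') - 1) ≤ Valued.v ϖ ^ N) → χ₁ u = 1 := by
  classical
  -- (a) `χ₁` is continuous into `ℂˣ`
  have hc : Continuous χ₁ :=
    Units.continuous_iff.2 ⟨h₁, (h₁.comp continuous_inv).congr fun x => by simp only [Function.comp_apply, map_inv]⟩
  -- (b) an open subgroup `H` on which `χ₁ = 1`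
  set U : Set ℂˣ := {z | ‖(z : ℂ) - 1‖ < 1} with hU
  have hUo : IsOpen U := isOpen_lt (Units.continuous_val.sub continuous_const).norm continuous_const
  have h1U : (1 : ℂˣ) ∈ U := by simp [hU]
  have hV : χ₁ ⁻¹' U ∈ 𝓝 (1 : (LocalRing L v)ˣ) := (hUo.preimage hc).mem_nhds (by simpa using h1U)
  obtain ⟨H, hHo, hHV⟩ := F0P3cStCharTSShellFn.exists_isOpen_subgroup_subset_units_localRing L v hV
  have hker : ∀ u ∈ H, χ₁ u = 1 := by
    intro u hu
    have hmem : ∀ x ∈ H, ‖((χ₁ x : ℂˣ) : ℂ) - 1‖ < 1 := fun x hx => hHV hx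
    refine Complex.units_eq_one_of_forall_norm_pow_sub_one_lt (fun n => ?_) (fun n => ?_)
    · have := hmem (u ^ n) (pow_mem hu n)
      simpa [map_pow] using this
    · have := hmem (u⁻¹ ^ n) (pow_mem (inv_mem hu) n)
      simpa [map_pow, map_inv] using this
  -- (c) `H ∈ 𝓝 1` contains a congruence ball: transport to `Π_{w′} (L_{w′})ˣ`
  have hH1 : (H : Set (LocalRing L v)ˣ) ∈ 𝓝 (1 : (LocalRing L v)ˣ) := hHo.mem_nhds H.one_mem
  let e : (LocalRing L v)ˣ ≃ₜ* ((w' : PlacesOver L v) → (w'.1.adicCompletion L)ˣ) := ContinuousMulEquiv.piUnits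
  have hH' : ⇑e.toHomeomorph '' (H : Set (LocalRing L v)ˣ) ∈ 𝓝 (1 : (w' : PlacesOver L v) → (w'.1.adicCompletion L)ˣ) := by
    have h := e.toHomeomorph.isOpenMap.image_mem_nhds hH1
    rwa [show (⇑e.toHomeomorph) 1 = 1 from map_one e] at h
  rw [nhds_pi, Filter.mem_pi] at hH'
  obtain ⟨I, -, t, ht, htH⟩ := hH'
  -- per place: a valuation ball around `1` inside `t w′`
  have hball : ∀ w' : PlacesOver L v, ∃ n : ℕ, ∀ y : (w'.1.adicCompletion L)ˣ,
      Valued.v ((y : w'.1.adicCompletion L) - 1) < WithZero.exp (-(n : ℤ)) → y ∈ t w' := by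
    intro w'
    have ht1 : t w' ∈ 𝓝 (1 : (w'.1.adicCompletion L)ˣ) := by simpa only [Pi.one_apply] using ht w'
    rw [Units.isEmbedding_val₀.nhds_eq_comap, Filter.mem_comap] at ht1
    obtain ⟨s, hs, hst⟩ := ht1
    rw [Units.val_one] at hs
    obtain ⟨n, hn⟩ := exists_exp_lt_of_mem_nhds w'.1 hs
    exact ⟨n, fun y hy => hst (hn _ hy)⟩
  choose n hn using hball
  refine ⟨Finset.univ.sum n + 1, fun u hu => hker u ?_⟩
  -- the level-`N` ball maps into `I.pi t`, hence into `e(H)`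
  have hϖN : Valued.v ϖ ^ (Finset.univ.sum n + 1) = WithZero.exp (-((Finset.univ.sum n + 1 : ℕ) : ℤ)) := by
    rw [hϖ, ← WithZero.exp_nsmul, smul_neg, nsmul_eq_mul, mul_one]
  have hu' : e u ∈ I.pi t := by
    intro w' _
    refine hn w' _ (lt_of_le_of_lt (hu w') ?_)
    rw [hϖN, WithZero.exp_lt_exp]
    have hle : n w' ≤ Finset.univ.sum n := Finset.single_le_sum (fun _ _ => Nat.zero_le _) (Finset.mem_univ w')
    omega
  obtain ⟨u', hu'H, hu'eq⟩ := htH hu'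
  have huu : u' = u := e.injective hu'eq
  exact huu ▸ hu'H

end Summit.HodgeConjecture.HodgeConjecture.Cruxes.H413.K2E3LocalCharacterSmoothLevel

end
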